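/-
Copyright (c) 2026 the pub-hodgecm-mathlib formalisation cell (harness21).  Prover seat hodgecm-mathlib-K2E3-p11 (g6), Track B «K2-LIT» ∕ h413
(`stmt-HodgeConjecture-24833`), line `K2_E3_EllipticInputs`, road (11-3-split-nsc) `sig_K2E3CharLocIntNearSemisimpleSplitThreeNonSupercuspidal` (U12 ED. 20 :419),
brick (nsc-vD-gen): THE CHARACTER OF `Ind_{P_c}^{GL_N}(χ)` IS AN INTEGRABLE FUNCTION NEAR EVERY POINT, GIVEN ABSOLUTE CONTINUITY OF THE `K M U` PUSH-FORWARD.  2026-09-04.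
-/
import Literature.NumberTheory.Automorphic.VanDijkTraceParabolicIndGLProof                      -- ★ KMU form `GLn.exists_smoothTrace_parabolicIndGL_eq_integral_KMU` + §1 helpers (`isCompact_glInt_mul_mul_glInt`, …)
import Literature.NumberTheory.Automorphic.GLnTwoBlockLeviStructure                              -- ★ `exists_homeomorph_levi_prod_unipotent_coe_eq` (`M_c × U_c ≃ₜ P_c`)
import Literature.NumberTheory.Automorphic.TateLocalFactors                                      -- ★ `SchwartzBruhat`
import Summits.HodgeConjecture.HodgeConjecture.Theorems.K2E3PushforwardDensityOfDomination        -- ★ (nsc-RN) p858445 `exists_integrable_forall_integral_mul_comp_eq`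
import HarnessLib

/-!
# K2_E3 road (h413), (11-3-split-nsc) brick (nsc-vD-gen) — van Dijk's induced character `χ_{Ind χ}` is an integrable function near every `g ∈ GL_N(F)`,
# from the `K M U` form and the absolute continuity of the conjugated `K × M_c × U_c` push-forward

Cell `pub/hodgecm-mathlib` (D-0151), Track B, seat K2E3-p11 (g6) = road owner of (11-3-split-nsc) (BRICK LIST v2, `K2/STATUS.md` 2026-09-04 ≈08:11Z).
`--supports stmt-HodgeConjecture-24833 --as helper`; THEOREMS ONLY (no definition ∕ instance ∕ notation ∕ named fact ∕ `sorry`); never imports `Cruxes/…/Lines`.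
COUNT-NEUTRAL.

THE MATHEMATICS ([vanDijk1972, Thm. p. 237]; [HarishChandra1999, §16 p. 77]; [Folland1999, Thm. 3.8]).  `F` a non-archimedean local field, `G = GL_N(F)`,
`K = GL_N(𝒪)`, `P_c = M_c U_c` a standard parabolic (monotone block label `c`), `χ` a character of the block Levi with open kernel.  ★ van Dijk's `K M U` form
(`GLn.exists_smoothTrace_parabolicIndGL_eq_integral_KMU`) says
`tr Ind(χ)(f dμ₀) = ∫_K C ∫_{M_c} ∫_{U_c} f(k⁻¹ (m u) k) · χ(m) δ_{P_c}^{1∕2}(m) dμ_U dν_M dμ_K`,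
i.e. the character is the push-forward under `Ψ(k, m, u) = k⁻¹ (m u) k` of the measure `C·χδ^{1∕2} · (μ_K ⊗ ν_M ⊗ μ_U)`.  HYPOTHESIS (AC): for every Haar triple
`(ν_M, μ_U, μ_K)` the push-forward `Ψ_*(μ_K ⊗ ν_M ⊗ μ_U)` charges no `μ₀`-null set (this is the analytic heart — Harish-Chandra's submersion principle ∕ the
slice-density identities ★ (LBGL-3E)∕(3J) at `N = 3`; it is supplied per label by the bricks (nsc-K𝔭-AC), (nsc-K𝔟-D)).  CONCLUSION: for every `g ∈ G` there are
an open `U ∋ g` and `Θ ∈ L¹(U, μ₀)` with `tr Ind(χ)(f dμ₀) = ∫ f Θ dμ₀` for all Schwartz–Bruhat `f` supported in `U` — the conclusion of row 11 (GL-11) for the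
class of `Ind(χ)`, at EVERY point (semisimple or not).  PROOF: `U := g·K` (compact open); if `f` lives on `U` then `f(k⁻¹(mu)k) ≠ 0` forces `m u ∈ K·U·K`
(compact), so `(m, u)` ranges in a compact `S ⊆ M_c × U_c` (`M_c × U_c ≃ₜ P_c` closed in `G`), inside a compact box `S_M × S_U`; on `X = K × S_M × S_U`
the parameter measure is FINITE and the weight `C·χδ^{1∕2}` is BOUNDED, and (AC) makes `(Ψ_*μ_X)|_U ≪ μ₀`; ★ (nsc-RN) (Radon–Nikodym) produces `Θ`.

* **`charLocIntNear_parabolicIndGL_of_ac`** — the statement above, for every `N`, every monotone `c`, every `χ` with open kernel, every Haar `μ₀` (any Borel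
  structure on `GL_N(F)`), under (AC).

HONEST LABEL: HC_CM is proved only modulo the 7 printed citations (2 remaining named inputs: hLiu418 = stmt-HodgeConjecture-24832, h413 =
stmt-HodgeConjecture-24833) until rung 0 closes; count-neutral helper; (AC) is a hypothesis here, paid per label elsewhere on the road.

## References
* [vanDijk1972] G. van Dijk, *Computation of certain induced characters of 𝔭-adic groups*, Math. Ann. 199 (1972), 229–240, Thm. p. 237.
* [HarishChandra1999] Harish-Chandra (DeBacker–Sally), *Admissible Invariant Distributions on Reductive p-adic Groups* (1999), §16 Thm. 16.1 p. 77.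
* [BernsteinZelevinsky1977] I. N. Bernstein, A. V. Zelevinsky, *Induced representations of reductive 𝔭-adic groups I*, §2.3.
* [Folland1999] G. B. Folland, *Real Analysis*, 2nd ed. (1999), §3.2 Thm. 3.8.
-/

set_option autoImplicit false
set_option linter.dupNamespace false

noncomputable section

open MeasureTheory MeasureTheory.Measure Topology TopologicalSpace Set
open scoped MatrixGroups NNReal ENNReal

namespace Summit.HodgeConjecture.HodgeConjecture.Cruxes.H413.K2E3CharLocIntNearParabolicIndOfAC

open Literature.NumberTheory.Automorphic
open Literature.NumberTheory.GaloisRepresentations.IsNonarchimedeanLocalField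
open Summit.HodgeConjecture.HodgeConjecture.Cruxes.H413.K2E3PushforwardDensityOfDomination

variable {F : Type} [Field F] [ValuativeRel F] [TopologicalSpace F] [IsNonarchimedeanLocalField F]
  {N : ℕ} {α : Type*} [LinearOrder α] [Fintype α] {c : Fin N → α}
  [MeasurableSpace (GL (Fin N) F)] [BorelSpace (GL (Fin N) F)]

set_option maxHeartbeats 3200000 in
/-- **(nsc-vD-gen) THE INDUCED CHARACTER `χ_{Ind_{P_c}(χ)}` IS AN INTEGRABLE FUNCTION NEAR EVERY POINT, GIVEN (AC).**  `c` monotone, `χ` a character of the block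
Levi with open kernel, `μ₀` a Haar measure on `GL_N(F)`.  Assume (AC): for all Haar measures `ν_M` on `M_c`, `μ_U` on `U_c`, `μ_K` on `K = GL_N(𝒪)` and every
measurable `μ₀`-null `A ⊆ GL_N(F)`, the set `{(k, m, u) | k⁻¹ (m u) k ∈ A}` is `μ_K ⊗ (ν_M ⊗ μ_U)`-null.  Then for every `g` there are an open `U ∋ g` and
`Θ : GL_N(F) → ℂ` integrable on `U` with `tr (parabolicIndGL F c (𝟙.twist χ))(f dμ₀) = ∫ f Θ dμ₀` for every Schwartz–Bruhat `f` with `tsupport f ⊆ U`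
(★ KMU form, localisation to a compact box of parameters, ★ Radon–Nikodym (nsc-RN)). [cite: vanDijk1972, Thm. p. 237] [cite: HarishChandra1999, §16 Thm. 16.1 p. 77]
[cite: BernsteinZelevinsky1977, §2.3] [cite: Folland1999, §3.2 Thm. 3.8] -/
theorem charLocIntNear_parabolicIndGL_of_ac (hc : Monotone c)
    (χ : (Π a, GL {i : Fin N // c i = a} F) →* ℂˣ) (hχ : IsOpen (χ.ker : Set (Π a, GL {i : Fin N // c i = a} F)))
    (μ₀ : Measure (GL (Fin N) F)) [μ₀.IsHaarMeasure]
    (hAC : ∀ (νM : Measure ↥(standardLeviGL F c)) [νM.IsHaarMeasure] (μU : Measure ↥(unipotentRadicalGL F c)) [μU.IsHaarMeasure]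
      (μK : Measure ↥(glInt N F)) [μK.IsHaarMeasure] (A : Set (GL (Fin N) F)), MeasurableSet A → μ₀ A = 0 →
      (μK.prod (νM.prod μU)) {t : ↥(glInt N F) × (↥(standardLeviGL F c) × ↥(unipotentRadicalGL F c)) |
        ((t.1 : GL (Fin N) F))⁻¹ * ((t.2.1 : GL (Fin N) F) * (t.2.2 : GL (Fin N) F)) * (t.1 : GL (Fin N) F) ∈ A} = 0)
    (g : GL (Fin N) F) :
    ∃ U : Set (GL (Fin N) F), IsOpen U ∧ g ∈ U ∧ ∃ Θ : GL (Fin N) F → ℂ, IntegrableOn Θ U μ₀ ∧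
      ∀ f : GL (Fin N) F → ℂ, f ∈ SchwartzBruhat (GL (Fin N) F) → tsupport f ⊆ U →
        (Representation.parabolicIndGL F c ((Representation.trivial ℂ (Π a, GL {i : Fin N // c i = a} F) ℂ).twist χ)).smoothTrace μ₀ f =
          ∫ x, f x * Θ x ∂μ₀ := by
  classical
  ------------------------------------------------------------------
  -- frame: topology and measurability of `G`, `K`, `M_c`, `U_c`, `P_c`
  ------------------------------------------------------------------
  haveI : T2Space F := (isLocalField F).toT2Space
  haveI : LocallyCompactSpace F := (isLocalField F).toLocallyCompactSpace
  haveI : SecondCountableTopology F := secondCountableTopology_localField F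
  haveI : SecondCountableTopology (Matrix (Fin N) (Fin N) F) := inferInstanceAs (SecondCountableTopology (Fin N → Fin N → F))
  haveI : SecondCountableTopology (Matrix (Fin N) (Fin N) F)ᵐᵒᵖ := MulOpposite.opHomeomorph.symm.secondCountableTopology
  haveI : SecondCountableTopology (GL (Fin N) F) := Units.isEmbedding_embedProduct.secondCountableTopology
  haveI : LocallyCompactSpace (Matrix (Fin N) (Fin N) F) := inferInstanceAs (LocallyCompactSpace (Fin N → Fin N → F))
  haveI : LocallyCompactSpace (GL (Fin N) F) := inferInstance
  have hKo : IsOpen (glInt N F : Set (GL (Fin N) F)) := isOpen_glInt (n := N) (F := F)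
  have hKc : IsCompact (glInt N F : Set (GL (Fin N) F)) := isCompact_glInt (n := N) (F := F)
  haveI : CompactSpace ↥(glInt N F) := isCompact_iff_compactSpace.1 hKc
  have hPcl : IsClosed (standardParabolicGL F c : Set (GL (Fin N) F)) := isClosed_standardParabolicGL F c
  have hMcl : IsClosed (standardLeviGL F c : Set (GL (Fin N) F)) := isClosed_standardLeviGL (R := F) c
  have hUcl : IsClosed (unipotentRadicalGL F c : Set (GL (Fin N) F)) := isClosed_unipotentRadicalGL (R := F) c
  haveI : SecondCountableTopology ↥(standardLeviGL F c) := inferInstanceAs (SecondCountableTopology ↥((standardLeviGL F c : Set (GL (Fin N) F))))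
  haveI : SecondCountableTopology ↥(unipotentRadicalGL F c) :=
    inferInstanceAs (SecondCountableTopology ↥((unipotentRadicalGL F c : Set (GL (Fin N) F))))
  haveI : SecondCountableTopology ↥(glInt N F) := inferInstanceAs (SecondCountableTopology ↥((glInt N F : Set (GL (Fin N) F))))
  haveI : LocallyCompactSpace ↥(standardLeviGL F c) := hMcl.locallyCompactSpace
  haveI : LocallyCompactSpace ↥(unipotentRadicalGL F c) := hUcl.locallyCompactSpace
  haveI : SigmaCompactSpace (GL (Fin N) F) := sigmaCompactSpace_of_locallyCompact_secondCountable
  haveI : SigmaCompactSpace ↥(standardLeviGL F c) := hMcl.isClosedEmbedding_subtypeVal.sigmaCompactSpace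
  haveI : SigmaCompactSpace ↥(unipotentRadicalGL F c) := hUcl.isClosedEmbedding_subtypeVal.sigmaCompactSpace
  haveI : BorelSpace (↥(standardLeviGL F c) × ↥(unipotentRadicalGL F c)) := Prod.borelSpace
  haveI : BorelSpace (↥(glInt N F) × (↥(standardLeviGL F c) × ↥(unipotentRadicalGL F c))) := Prod.borelSpace
  -- three Haar measures on `M_c`, `U_c`, `K`
  set νM : Measure ↥(standardLeviGL F c) := Measure.haar with hνM
  set μU : Measure ↥(unipotentRadicalGL F c) := Measure.haar with hμU
  set μK : Measure ↥(glInt N F) := Measure.haar with hμK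
  haveI : SigmaFinite νM := inferInstance
  haveI : SigmaFinite μU := inferInstance
  haveI : SigmaFinite μK := inferInstance
  haveI : IsFiniteMeasure μK := CompactSpace.isFiniteMeasure
  -- ★ the KMU form
  obtain ⟨μP, hμP, C, hC, -, -, hKMU⟩ :=
    GLn.exists_smoothTrace_parabolicIndGL_eq_integral_KMU (F := F) hc χ hχ μ₀ νM μU μK
  ------------------------------------------------------------------
  -- the neighbourhood `U = g·K` and the compact parameter box
  ------------------------------------------------------------------
  set U : Set (GL (Fin N) F) := (fun x : GL (Fin N) F => g * x) '' (glInt N F : Set (GL (Fin N) F)) with hUdef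
  have hUo : IsOpen U := (isOpenMap_mul_left g) _ hKo
  have hUc : IsCompact U := hKc.image (continuous_const.mul continuous_id)
  have hgU : g ∈ U := ⟨1, (glInt N F).one_mem, mul_one g⟩
  have hUm : MeasurableSet U := hUo.measurableSet
  -- `T = K · U · K` (compact): contains every `m u` with `k⁻¹ (m u) k ∈ U`
  set T : Set (GL (Fin N) F) := (fun t : GL (Fin N) F × GL (Fin N) F × GL (Fin N) F => t.1 * t.2.1 * t.2.2) ''
      ((glInt N F : Set (GL (Fin N) F)) ×ˢ U ×ˢ (glInt N F : Set (GL (Fin N) F))) with hTdef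
  have hT : IsCompact T := isCompact_glInt_mul_mul_glInt (F := F) (N := N) hUc
  have hmemT : ∀ (k : ↥(glInt N F)) (q : ↥(standardLeviGL F c) × ↥(unipotentRadicalGL F c)),
      (k : GL (Fin N) F)⁻¹ * ((q.1 : GL (Fin N) F) * (q.2 : GL (Fin N) F)) * (k : GL (Fin N) F) ∈ U →
        (q.1 : GL (Fin N) F) * (q.2 : GL (Fin N) F) ∈ T := by
    intro k q hq
    refine ⟨((k : GL (Fin N) F), (k : GL (Fin N) F)⁻¹ * ((q.1 : GL (Fin N) F) * (q.2 : GL (Fin N) F)) * (k : GL (Fin N) F), (k : GL (Fin N) F)⁻¹),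
      Set.mk_mem_prod k.2 (Set.mk_mem_prod hq ((glInt N F).inv_mem k.2)), ?_⟩
    simp only
    group
  -- the compact `S ⊆ M_c × U_c` of pairs with `m u ∈ T`, and its compact box `S_M × S_U`
  obtain ⟨e, he⟩ := exists_homeomorph_levi_prod_unipotent_coe_eq (R := F) (c := c)
  set S : Set (↥(standardLeviGL F c) × ↥(unipotentRadicalGL F c)) :=
    e.symm '' (((↑) : ↥(standardParabolicGL F c) → GL (Fin N) F) ⁻¹' T) with hSdef
  have hS : IsCompact S := (hPcl.isClosedEmbedding_subtypeVal.isCompact_preimage hT).image e.symm.continuous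
  have hmemS : ∀ q : ↥(standardLeviGL F c) × ↥(unipotentRadicalGL F c), (q.1 : GL (Fin N) F) * (q.2 : GL (Fin N) F) ∈ T → q ∈ S := by
    intro q hq
    refine ⟨e q, ?_, e.symm_apply_apply q⟩
    rw [Set.mem_preimage, he]
    exact hq
  set SM : Set ↥(standardLeviGL F c) := Prod.fst '' S with hSMdef
  set SU : Set ↥(unipotentRadicalGL F c) := Prod.snd '' S with hSUdef
  have hSM : IsCompact SM := hS.image continuous_fst
  have hSU : IsCompact SU := hS.image continuous_snd
  have hSMm : MeasurableSet SM := hSM.isClosed.measurableSet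
  have hSUm : MeasurableSet SU := hSU.isClosed.measurableSet
  have hSbox : S ⊆ SM ×ˢ SU := fun q hq => Set.mk_mem_prod ⟨q, hq, rfl⟩ ⟨q, hq, rfl⟩
  set Box : Set (↥(glInt N F) × (↥(standardLeviGL F c) × ↥(unipotentRadicalGL F c))) := (Set.univ : Set ↥(glInt N F)) ×ˢ (SM ×ˢ SU) with hBoxdef
  have hBoxm : MeasurableSet Box := MeasurableSet.univ.prod (hSMm.prod hSUm)
  ------------------------------------------------------------------
  -- the finite parameter measure, the map `Ψ`, the bounded weight
  ------------------------------------------------------------------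
  set Pm : Measure (↥(glInt N F) × (↥(standardLeviGL F c) × ↥(unipotentRadicalGL F c))) := μK.prod (νM.prod μU) with hPm
  set μX : Measure (↥(glInt N F) × (↥(standardLeviGL F c) × ↥(unipotentRadicalGL F c))) := Pm.restrict Box with hμX
  haveI : IsFiniteMeasure μX := by
    rw [hμX, hPm]
    refine isFiniteMeasure_restrict.2 (ne_of_lt ?_)
    rw [hBoxdef, Measure.prod_prod, Measure.prod_prod]
    exact ENNReal.mul_lt_top (measure_lt_top μK _) (ENNReal.mul_lt_top hSM.measure_lt_top hSU.measure_lt_top)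
  set Ψ : ↥(glInt N F) × (↥(standardLeviGL F c) × ↥(unipotentRadicalGL F c)) → GL (Fin N) F := fun t =>
      ((t.1 : GL (Fin N) F))⁻¹ * ((t.2.1 : GL (Fin N) F) * (t.2.2 : GL (Fin N) F)) * (t.1 : GL (Fin N) F) with hΨdef
  have hΨc : Continuous Ψ :=
    ((continuous_subtype_val.comp continuous_fst).inv.mul
      ((continuous_subtype_val.comp (continuous_fst.comp continuous_snd)).mul (continuous_subtype_val.comp (continuous_snd.comp continuous_snd)))).mul
      (continuous_subtype_val.comp continuous_fst)
  have hΨm : Measurable Ψ := hΨc.measurable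
  -- the weight `τ(m) = χ(m) δ^{1/2}(m)` (continuous) and `Fw = C · 1_{S_M} τ` (bounded measurable)
  set τM : ↥(standardLeviGL F c) → ℂ := fun m =>
      ((χ (leviProjection F c ⟨(m : GL (Fin N) F), standardLeviGL_le F c m.2⟩) : ℂˣ) : ℂ) *
        ((rootDeltaChar (standardParabolicGL F c) ⟨(m : GL (Fin N) F), standardLeviGL_le F c m.2⟩ : ℂˣ) : ℂ) with hτM
  have hτMc : Continuous τM :=
    ((isLocallyConstant_unitsCoe_of_isOpen_ker' χ hχ).continuous.comp
      ((continuous_leviProjection F c).comp (continuous_subtype_val.subtype_mk _))).mul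
      ((continuous_rootDeltaChar_unitsCoe' (standardParabolicGL F c)).comp (continuous_subtype_val.subtype_mk _))
  obtain ⟨B, hB⟩ := hSM.exists_bound_of_continuousOn hτMc.continuousOn
  set Fw : ↥(glInt N F) × (↥(standardLeviGL F c) × ↥(unipotentRadicalGL F c)) → ℂ := fun t => (C : ℂ) * SM.indicator τM t.2.1 with hFwdef
  have hFwm : Measurable Fw :=
    measurable_const.mul ((hτMc.measurable.indicator hSMm).comp (measurable_fst.comp measurable_snd))
  have hFwb : ∀ t, ‖Fw t‖ ≤ |C| * max B 0 := by
    intro t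
    rw [hFwdef]
    simp only [norm_mul, Complex.norm_real, Real.norm_eq_abs]
    refine mul_le_mul_of_nonneg_left ?_ (abs_nonneg _)
    by_cases hm : t.2.1 ∈ SM
    · rw [Set.indicator_of_mem hm]; exact (hB _ hm).trans (le_max_left _ _)
    · rw [Set.indicator_of_notMem hm, norm_zero]; exact le_max_right _ _
  -- (AC) ⇒ `(Ψ_* μX)|_U ≪ μ₀`
  have hac : ((μX.map Ψ).restrict U) ≪ μ₀ := by
    refine Measure.AbsolutelyContinuous.mk fun s hs hs0 => ?_
    have h1 : Pm (Ψ ⁻¹' s) = 0 := hAC νM μU μK s hs hs0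
    have h2 : μX (Ψ ⁻¹' s) = 0 := (Measure.absolutelyContinuous_of_le Measure.restrict_le_self) h1
    rw [Measure.restrict_apply hs, Measure.map_apply hΨm (hs.inter hUm)]
    exact measure_mono_null (Set.preimage_mono Set.inter_subset_left) h2
  -- ★ Radon–Nikodym
  obtain ⟨Θ, hΘi, hΘ⟩ := exists_integrable_forall_integral_mul_comp_eq μX hΨm hFwm hFwb μ₀ hUm hac
  refine ⟨U, hUo, hgU, Θ, hΘi.integrableOn, fun f hf hfU => ?_⟩
  ------------------------------------------------------------------
  -- the test function: continuous, bounded, vanishing off `U`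
  ------------------------------------------------------------------
  have hflc : IsLocallyConstant f := (mem_schwartzBruhat_iff.1 hf).1
  have hfcs : HasCompactSupport f := (mem_schwartzBruhat_iff.1 hf).2
  have hfc : Continuous f := hflc.continuous
  obtain ⟨Bf, hBf⟩ := hfc.bounded_above_of_compact_support hfcs
  have hfU' : ∀ x, x ∉ U → f x = 0 := fun x hx => image_eq_zero_of_notMem_tsupport fun h => hx (hfU h)
  rw [← hΘ f Bf hfc.measurable hBf hfU', hKMU f hflc hfcs]
  ------------------------------------------------------------------
  -- Fubini: `∫_K C ∫_M ∫_U (…) = ∫_{Box} Fw · (f ∘ Ψ) d(μ_K ⊗ ν_M ⊗ μ_U)`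
  ------------------------------------------------------------------
  set H3 : ↥(glInt N F) × (↥(standardLeviGL F c) × ↥(unipotentRadicalGL F c)) → ℂ := fun t => f (Ψ t) * τM t.2.1 with hH3
  have hH3c : Continuous H3 := (hfc.comp hΨc).mul (hτMc.comp (continuous_fst.comp continuous_snd))
  -- support: `f(Ψ(k,q)) ≠ 0 ⇒ q ∈ S`
  have hsuppS : ∀ (k : ↥(glInt N F)) (q : ↥(standardLeviGL F c) × ↥(unipotentRadicalGL F c)), f (Ψ (k, q)) ≠ 0 → q ∈ S :=
    fun k q hne => hmemS q (hmemT k q (hfU (subset_tsupport _ hne)))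
  have hzero : ∀ t : ↥(glInt N F) × (↥(standardLeviGL F c) × ↥(unipotentRadicalGL F c)), t.2 ∉ S → H3 t = 0 := by
    intro t ht
    simp only [hH3]
    by_contra hne
    exact ht (hsuppS t.1 t.2 fun h => hne (by rw [h, zero_mul]))
  have hH3s : HasCompactSupport H3 := by
    refine HasCompactSupport.intro' (isCompact_univ.prod hS) (isClosed_univ.prod hS.isClosed) fun t ht => ?_
    exact hzero t fun h => ht (Set.mk_mem_prod (Set.mem_univ _) h)
  have hI2 : Integrable H3 Pm := hH3c.integrable_of_hasCompactSupport hH3s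
  have hIk : ∀ k : ↥(glInt N F), Integrable (fun q : ↥(standardLeviGL F c) × ↥(unipotentRadicalGL F c) => H3 (k, q)) (νM.prod μU) := fun k =>
    (hH3c.comp (Continuous.prodMk_right k)).integrable_of_hasCompactSupport
      (HasCompactSupport.intro' hS hS.isClosed fun q hq => hzero (k, q) hq)
  -- Step A: the inner double integral is a product integral
  have hA : ∀ k : ↥(glInt N F), ∫ m : ↥(standardLeviGL F c), ∫ u : ↥(unipotentRadicalGL F c),
      f ((k : GL (Fin N) F)⁻¹ * ((m : GL (Fin N) F) * (u : GL (Fin N) F)) * (k : GL (Fin N) F)) * τM m ∂μU ∂νM =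
      ∫ q : ↥(standardLeviGL F c) × ↥(unipotentRadicalGL F c), H3 (k, q) ∂(νM.prod μU) := by
    intro k
    rw [integral_prod _ (hIk k)]
  have hτM' : ∀ m : ↥(standardLeviGL F c), ((χ (leviProjection F c ⟨(m : GL (Fin N) F), standardLeviGL_le F c m.2⟩) : ℂˣ) : ℂ) *
      ((rootDeltaChar (standardParabolicGL F c) ⟨(m : GL (Fin N) F), standardLeviGL_le F c m.2⟩ : ℂˣ) : ℂ) = τM m := fun m => rfl
  simp_rw [hτM', hA]
  -- Step B: `∫_K C · ∫_{M×U} = ∫_{K×(M×U)} C · H3`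
  have hI2C : Integrable (fun t : ↥(glInt N F) × (↥(standardLeviGL F c) × ↥(unipotentRadicalGL F c)) => (C : ℂ) * H3 t) Pm := hI2.const_mul _
  have hB' : ∫ k : ↥(glInt N F), (C : ℂ) * ∫ q : ↥(standardLeviGL F c) × ↥(unipotentRadicalGL F c), H3 (k, q) ∂(νM.prod μU) ∂μK =
      ∫ t, (C : ℂ) * H3 t ∂Pm := by
    rw [hPm, integral_prod _ hI2C]
    refine integral_congr_ae (Filter.Eventually.of_forall fun k => ?_)
    simp only
    rw [integral_const_mul]
  rw [hB']
  -- Step C: restrict to the box, where `C · H3 = Fw · (f ∘ Ψ)`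
  have hptw : ∀ t, Box.indicator (fun t => Fw t * f (Ψ t)) t = (C : ℂ) * H3 t := by
    intro t
    by_cases ht : t ∈ Box
    · have hm : t.2.1 ∈ SM := (Set.mem_prod.1 (Set.mem_prod.1 ht).2).1
      rw [Set.indicator_of_mem ht, hFwdef, hH3]
      simp only
      rw [Set.indicator_of_mem hm]
      ring
    · have ht2 : t.2 ∉ S := fun h => ht (Set.mk_mem_prod (Set.mem_univ _) (hSbox h))
      rw [Set.indicator_of_notMem ht, hzero t ht2, mul_zero]
  rw [hμX, ← integral_indicator hBoxm]
  exact integral_congr_ae (Filter.Eventually.of_forall fun t => (hptw t).symm)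

end Summit.HodgeConjecture.HodgeConjecture.Cruxes.H413.K2E3CharLocIntNearParabolicIndOfAC

end
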